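import Literature.AnabelianGeometry.AbsoluteAnabelian.AbsTopII.TwoTripodNodalIndexSections
import HarnessLib

/-!
# [AbsTopII] Prop 1.3 (x) at the index-`i` two-vertex datum, II: the log points — smooth, cuspidal AND NODAL members

S. Mochizuki, *Topics in Absolute Anabelian Geometry II* [AbsTopII] (bib `MochizukiAbsTopII2013`; locators =
PDF pages of the kurims manuscript `paper:url-585b8d0ad0d9`), §1, Ex 1.1 (iii) p. 9 ("`ξ + η = i_e · σ`"), Def 1.2 (ii)
p. 10, Prop 1.3 (x) p. 12:

> "(x) Let `τ_I : I → Π_I` be the [outer] homomorphism that arises [by functoriality!] from a 'log point'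
> `τ_S ∈ X^{log}(S^{log})`. […] `τ_I` is non-verticial and satisfies the condition `τ_I(I) ⊆ I_{e_τ}` for some node
> `e_τ` […] if and only if the image of `τ_S` is the node of `X` corresponding to `e_τ`."

MODEL/CONSTRUCTION file (definitions + defining lemmas; abc-iut-f-066 gen 8, row «TWO-VERTEX-Σ-INDEX-i»), companion of
`AbsTopII/TwoTripodNodalIndexDatum.lean` (the index-`i` datum `M.dpscIdx`: node index `i_e = i^Σ_e = i`,
`Π_I = Π_𝔾 · closure ⟨t₀^i⟩`, `I_{v_A} = closure ⟨t₀^i⟩`, `I_{v_B} = closure ⟨u₀^i⟩`, `I_e = Π_e · closure ⟨t₀^i⟩`).  It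
supplies the FAMILY of labelled sections `M.logPointsIdx : M.LogPtIdx i → (M.dpscIdx …).LogPointData` on which the
statement of record `DPSCIndexData.Prop_1_3_x''` is evaluated (`TwoTripodNodalIndexProp13x.lean`), read off the log
structure exactly as in abc-iut-f-066 gen 7's `TwoTripodNodalLogPoints.lean` (the case `i = 1`), now with `s_j^i`,
`t₀^i` generating `I_v`:

* SMOOTH points of the component `v` ↦ the sections `δ I_v δ⁻¹`;
* log points over the CUSP `c_j` ↦ the slope-`n` sections `δ · closure ⟨ι(c_j)^n · s_j^i⟩ · δ⁻¹`, `n ≥ 1`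
  (`M_{c_j} → M_S`: `ζ ↦ n·σ` with `n ≥ 1`);
* log points over the NODE ↦ the sections `δ · closure ⟨w^{-m} · t₀^i⟩ · δ⁻¹`, `0 < m < i` — NEW at node index `i ≥ 2`:
  a log point over the node gives `M_e → M_S`, `ξ ↦ m·σ`, `η ↦ (i−m)·σ` with `m, i−m ≥ 1` (in `M_e` one has
  `ξ + η = i·σ`, Ex 1.1 (iii)), and in `I_e = Hom(M_e^gp, Ẑ^Σ(1)) = Π_e × closure ⟨t₀^i⟩` (coordinates `w ↔ (ξ ↦ −1, σ ↦ 0)`,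
  `t₀^i ↔ (ξ ↦ 0, σ ↦ 1)`, so that `I_{v_B} = closure ⟨w^{-i}t₀^i⟩ ↔ (η ↦ 0)`) its section is `closure ⟨w^{-m} t₀^i⟩`;
  `m = 0`, `m = i` are the inertia sections `I_{v_A}`, `I_{v_B}` themselves (`nodeSection_zero`, `nodeSection_self`).
Group theory (from `TwoTripodNodalIndexSections.lean`): each section is the graph of a continuous homomorphism out of
`closure ⟨s^i⟩ ≅ Ẑ^Σ`, meets `Π_𝔾` trivially and supplements it in `Π_I^{(i)}`.
HONEST FRAMING: constructed ≠ geometric (the family is the model's LABEL for the log points of the degenerate curve with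
node index `i`; Riemann existence / log specialisation are not in the tree); definitions + defining lemmas only; nothing
of Prop 1.3 (x) is asserted here; no side taken on [IUTchIII] Cor 3.12.
-/

noncomputable section

open scoped Pointwise

namespace Literature.AnabelianGeometry.AbsoluteAnabelian.AbsTopII.TwoTripodNodal.Model

open Literature.AnabelianGeometry.SemiGraphs
open Literature.AnabelianGeometry.SemiGraphs.SemiGraphOfAnabelioids (IsProSigmaCompletion)
open Literature.AnabelianGeometry.SemiGraphs.SemiGraphOfAnabelioids.IsProSigmaCompletion
open Literature.AnabelianGeometry.Anabelioids (IsSigmaInteger)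
open Literature.GroupTheory.CombinatorialGroupTheory
open Literature.GroupTheory.CombinatorialGroupTheory.PuncturedSurfaceGroup
open _root_.Topology

variable {Sigma : Set ℕ} (M : Model Sigma) (i : ℕ)

/-! ### The inertia sections of the vertices and of the cusps' vertices at index `i` -/

/-- The inertia section of the vertex `v` at node index `i`: `I_{v_A} = closure ⟨t₀^i⟩`, `I_{v_B} = closure ⟨u₀^i⟩`.
[cite: MochizukiAbsTopII2013, Prop 1.3 (iii) p.11] -/
def vertSecIdx : Fin 2 → Subgroup M.P := ![M.Tpow i, M.Upow i]

/-- The inertia section of the cusp `c_j`'s vertex at node index `i`: `closure ⟨t₀^i⟩` for `c₁, c₂`, `closure ⟨u₀^i⟩`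
for `c₃, c₀`. [cite: MochizukiAbsTopII2013, Prop 1.3 (iii) p.11] -/
def baseSecIdx : Fin 4 → Subgroup M.P := ![M.Upow i, M.Tpow i, M.Tpow i, M.Upow i]

section
variable (hne : Sigma.Nonempty) (hprime : ∀ p ∈ Sigma, p.Prime) (hi : IsSigmaInteger Sigma i)

/-- `I_v(dpscIdx) = vertSecIdx i v`. [cite: MochizukiAbsTopII2013, Prop 1.3 (iii) p.11] -/
theorem Iv_eq_vertSecIdx (v : (M.dpscIdx hne hprime i hi).Vert) :
    (M.dpscIdx hne hprime i hi).Iv v = M.vertSecIdx i v.down :=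
  M.Iv_dpscIdx_eq i hne hprime hi v

/-- `vertSecIdx i v = I_{⟨v⟩}(dpscIdx)`. [cite: MochizukiAbsTopII2013, Prop 1.3 (iii) p.11] -/
theorem vertSecIdx_eq_Iv (v : Fin 2) : M.vertSecIdx i v = (M.dpscIdx hne hprime i hi).Iv ⟨v⟩ :=
  (M.Iv_dpscIdx_eq i hne hprime hi ⟨v⟩).symm

end

/-- `vertSecIdx i v ⊆ vertSec v` (`closure ⟨t₀^i⟩ ⊆ T`, `closure ⟨u₀^i⟩ ⊆ U`). [cite: MochizukiAbsTopII2013, Prop 1.3 (iii) p.11] -/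
theorem vertSecIdx_le_vertSec (v : Fin 2) : M.vertSecIdx i v ≤ M.vertSec v := by
  fin_cases v
  · exact M.Tpow_le_T i
  · exact M.Upow_le_U i

/-- `vertSecIdx i v` is closed. [cite: MochizukiAbsTopII2013, Prop 1.3 (iii) p.11] -/
theorem isClosed_vertSecIdx (v : Fin 2) : IsClosed ((M.vertSecIdx i v : Subgroup M.P) : Set M.P) := by
  fin_cases v <;> exact Subgroup.isClosed_topologicalClosure _

/-- `vertSecIdx i v ∩ Π_𝔾 = 1`. [cite: MochizukiAbsTopII2013, Prop 1.3 (iii) p.11] -/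
theorem vertSecIdx_inf_PiG (hne : Sigma.Nonempty) (hprime : ∀ p ∈ Sigma, p.Prime) (v : Fin 2) :
    M.vertSecIdx i v ⊓ M.PiG = ⊥ := by
  fin_cases v
  · exact M.Tpow_inf_PiG i
  · exact M.Upow_inf_PiG i hne hprime

/-- `vertSecIdx i v · Π_𝔾 = Π_I^{(i)}`. [cite: MochizukiAbsTopII2013, Prop 1.3 (iii) p.11] -/
theorem vertSecIdx_sup_PiG (v : Fin 2) : M.vertSecIdx i v ⊔ M.PiG = M.PiIdx i := by
  fin_cases v
  · exact M.Tpow_sup_PiG i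
  · exact M.Upow_sup_PiG i

/-- `baseSecIdx i j = closure ⟨s_j^i⟩` (`s_j = baseGen j`). [cite: MochizukiAbsTopII2013, Prop 1.3 (iii) p.11] -/
theorem baseSecIdx_eq_closure_zpowers (j : Fin 4) :
    M.baseSecIdx i j = (Subgroup.zpowers (M.baseGen j ^ i)).topologicalClosure := by
  have h1 : M.baseGen 1 = M.ι (SemidirectProduct.inr (Multiplicative.ofAdd (1 : ℤ))) := by
    show M.ι (SemidirectProduct.inl 1 * _) = _; rw [map_one, one_mul]
  have h2 : M.baseGen 2 = M.ι (SemidirectProduct.inr (Multiplicative.ofAdd (1 : ℤ))) := by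
    show M.ι (SemidirectProduct.inl 1 * _) = _; rw [map_one, one_mul]
  fin_cases j
  · rfl
  · show M.Tpow i = (Subgroup.zpowers (M.baseGen 1 ^ i)).topologicalClosure; rw [h1]; rfl
  · show M.Tpow i = (Subgroup.zpowers (M.baseGen 2 ^ i)).topologicalClosure; rw [h2]; rfl
  · rfl

/-- `s_j^i ∈ baseSecIdx i j`. [cite: MochizukiAbsTopII2013, Prop 1.3 (iii) p.11] -/
theorem baseGen_pow_mem_baseSecIdx (j : Fin 4) : M.baseGen j ^ i ∈ M.baseSecIdx i j := by
  rw [baseSecIdx_eq_closure_zpowers]; exact Subgroup.le_topologicalClosure _ (Subgroup.mem_zpowers _)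

/-- `baseSecIdx i j ⊆ baseSec j`. [cite: MochizukiAbsTopII2013, Prop 1.3 (iii) p.11] -/
theorem baseSecIdx_le_baseSec (j : Fin 4) : M.baseSecIdx i j ≤ M.baseSec j := by
  fin_cases j
  · exact M.Upow_le_U i
  · exact M.Tpow_le_T i
  · exact M.Tpow_le_T i
  · exact M.Upow_le_U i

/-- `baseSecIdx i j` is closed. [cite: MochizukiAbsTopII2013, Prop 1.3 (iii) p.11] -/
theorem isClosed_baseSecIdx (j : Fin 4) : IsClosed ((M.baseSecIdx i j : Subgroup M.P) : Set M.P) := by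
  rw [baseSecIdx_eq_closure_zpowers]; exact Subgroup.isClosed_topologicalClosure _

/-- `baseSecIdx i j ∩ Π_𝔾 = 1`. [cite: MochizukiAbsTopII2013, Prop 1.3 (iii) p.11] -/
theorem baseSecIdx_inf_PiG (hne : Sigma.Nonempty) (hprime : ∀ p ∈ Sigma, p.Prime) (j : Fin 4) :
    M.baseSecIdx i j ⊓ M.PiG = ⊥ := by
  fin_cases j
  · exact M.Upow_inf_PiG i hne hprime
  · exact M.Tpow_inf_PiG i
  · exact M.Tpow_inf_PiG i
  · exact M.Upow_inf_PiG i hne hprime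

/-- `Π_𝔾 · baseSecIdx i j = Π_I^{(i)}`. [cite: MochizukiAbsTopII2013, Prop 1.3 (iii) p.11] -/
theorem PiG_sup_baseSecIdx (j : Fin 4) : M.PiG ⊔ M.baseSecIdx i j = M.PiIdx i := by
  fin_cases j
  · exact (M.PiIdx_eq_PiG_sup_Upow i).symm
  · rfl
  · rfl
  · exact (M.PiIdx_eq_PiG_sup_Upow i).symm

/-- `baseSecIdx i j ≅ Ẑ^Σ`. [cite: MochizukiAbsTopII2013, Prop 1.3 (iii) p.11] -/
theorem isFreeProSigmaCyclic_baseSecIdx (hne : Sigma.Nonempty) (hprime : ∀ p ∈ Sigma, p.Prime)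
    (hi : IsSigmaInteger Sigma i) (j : Fin 4) : IsFreeProSigmaCyclic Sigma ↥(M.baseSecIdx i j) := by
  fin_cases j
  · exact M.isFreeProSigmaCyclic_Upow i hne hprime hi
  · exact M.isFreeProSigmaCyclic_Tpow i hi
  · exact M.isFreeProSigmaCyclic_Tpow i hi
  · exact M.isFreeProSigmaCyclic_Upow i hne hprime hi

/-- `baseSecIdx i j` commutes with `ι(Π_{c_j})`. [cite: MochizukiAbsTopII2013, Prop 1.3 (iii) p.11] -/
theorem baseSecIdx_commute_cuspGp (j : Fin 4) :
    ∀ s ∈ M.baseSecIdx i j, ∀ x ∈ (M.cuspGp j).map M.PiG.subtype, x * s = s * x := fun _ hs x hx =>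
  Subgroup.mem_centralizer_iff.mp (M.baseSec_le_centralizer_cuspGp j (M.baseSecIdx_le_baseSec i j hs)) x hx

/-- `baseSecIdx i j = I_v(dpscIdx)` for the vertex `v` of the cusp `c_j`. [cite: MochizukiAbsTopII2013, Prop 1.3 (iii) p.11] -/
theorem baseSecIdx_eq_Iv (hne : Sigma.Nonempty) (hprime : ∀ p ∈ Sigma, p.Prime) (hi : IsSigmaInteger Sigma i) (j : Fin 4) :
    M.baseSecIdx i j = (M.dpscIdx hne hprime i hi).Iv ((M.dpscIdx hne hprime i hi).cuspVert ⟨j⟩) := by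
  fin_cases j
  · exact (M.Iv_one_dpscIdx i hne hprime hi).symm
  · exact (M.Iv_zero_dpscIdx i hne hprime hi).symm
  · exact (M.Iv_zero_dpscIdx i hne hprime hi).symm
  · exact (M.Iv_one_dpscIdx i hne hprime hi).symm

/-! ### The slope sections of the cusps at index `i` -/

/-- The generator `ι(c_j)^n · s_j^i` of the slope-`n` section at the cusp `c_j`, node index `i`.
[cite: MochizukiAbsTopII2013, Prop 1.3 (x) p.12] -/
def cuspGenIdx (j : Fin 4) (n : ℕ) : M.P :=
  M.ι (SemidirectProduct.inl (c j ^ n : PuncturedSurfaceGroup 0 4)) * M.baseGen j ^ i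

/-- **The slope-`n` section at the cusp `c_j`, node index `i`**: `closure ⟨ι(c_j)^n · s_j^i⟩` — the graph of the
continuous homomorphism `I_v = closure ⟨s_j^i⟩ → Π_{c_j}`, `s_j^i ↦ ι(c_j)^n`, inside `D_{c_j} = Π_{c_j} · I_v(dpsc)`.
[cite: MochizukiAbsTopII2013, Prop 1.3 (x) p.12] -/
def cuspSectionIdx (j : Fin 4) (n : ℕ) : Subgroup M.P := (Subgroup.zpowers (M.cuspGenIdx i j n)).topologicalClosure

/-- `ι(c_j)^n · s_j^i ∈ cuspSectionIdx i j n`. [cite: MochizukiAbsTopII2013, Prop 1.3 (x) p.12] -/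
theorem cuspGenIdx_mem (j : Fin 4) (n : ℕ) : M.cuspGenIdx i j n ∈ M.cuspSectionIdx i j n :=
  Subgroup.le_topologicalClosure _ (Subgroup.mem_zpowers _)

/-- `cuspSectionIdx i j n` is closed. [cite: MochizukiAbsTopII2013, Prop 1.3 (x) p.12] -/
theorem isClosed_cuspSectionIdx (j : Fin 4) (n : ℕ) : IsClosed ((M.cuspSectionIdx i j n : Subgroup M.P) : Set M.P) :=
  Subgroup.isClosed_topologicalClosure _

/-- `κG(c_j^n) ∈ Π_{c_j}`. [cite: MochizukiCombGC2007, Def 1.1(ii) p.7] -/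
theorem κG_pow_mem_cuspGp (j : Fin 4) (n : ℕ) : M.κG (c j ^ n) ∈ M.cuspGp j :=
  Subgroup.le_topologicalClosure _ (Subgroup.mem_map_of_mem _
    (by rw [PuncturedSurfaceGroup.cuspInertia]; exact Subgroup.pow_mem _ (Subgroup.mem_zpowers _) n))

/-- **`cuspSectionIdx ∩ Π_𝔾 = 1`** (graph of `θ : closure ⟨s_j^i⟩ → Π_{c_j}`; `closure ⟨s_j^i⟩ ∩ Π_𝔾 = 1`).
[cite: MochizukiAbsTopII2013, Prop 1.3 (x) p.12] -/
theorem cuspSectionIdx_inf_PiG (hne : Sigma.Nonempty) (hprime : ∀ p ∈ Sigma, p.Prime) (hi : IsSigmaInteger Sigma i)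
    (j : Fin 4) (n : ℕ) : M.cuspSectionIdx i j n ⊓ M.PiG = ⊥ := by
  have h := M.graphSection_inf_PiG (M.isClosed_baseSecIdx i j) (M.isFreeProSigmaCyclic_baseSecIdx i hne hprime hi j)
    (M.baseSecIdx_eq_closure_zpowers i j) (M.baseGen_pow_mem_baseSecIdx i j) (M.baseSecIdx_inf_PiG i hne hprime j)
    (Subgroup.isClosed_topologicalClosure _) (M.baseSecIdx_commute_cuspGp i j) (M.κG_pow_mem_cuspGp j n)
  rw [coe_κG] at h
  exact h

/-- **`cuspSectionIdx · Π_𝔾 = Π_I^{(i)}`**. [cite: MochizukiAbsTopII2013, Prop 1.3 (x) p.12] -/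
theorem cuspSectionIdx_sup_PiG (j : Fin 4) (n : ℕ) : M.cuspSectionIdx i j n ⊔ M.PiG = M.PiIdx i := by
  rw [← M.PiG_sup_baseSecIdx i j]
  exact M.graphSection_sup_PiG (M.isClosed_baseSecIdx i j) (M.baseSecIdx_eq_closure_zpowers i j)
    (M.baseGen_pow_mem_baseSecIdx i j) (Subgroup.map_subtype_le _ (M.inl_pow_mem_cuspGp_map j n))

/-- `cuspSectionIdx ⊆ Π_I^{(i)}`. [cite: MochizukiAbsTopII2013, Prop 1.3 (x) p.12] -/
theorem cuspSectionIdx_le_PiIdx (j : Fin 4) (n : ℕ) : M.cuspSectionIdx i j n ≤ M.PiIdx i := by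
  rw [← M.cuspSectionIdx_sup_PiG i j n]; exact le_sup_left

/-- **`cuspSectionIdx ⊆ D_{c_j} = Π_{c_j} · I_v(dpsc)`** (inside `P`). [cite: MochizukiAbsTopII2013, Prop 1.3 (x) p.12] -/
theorem cuspSectionIdx_le_cuspD (hne : Sigma.Nonempty) (hprime : ∀ p ∈ Sigma, p.Prime) (j : Fin 4) (n : ℕ) :
    M.cuspSectionIdx i j n ≤ (M.cuspGp j).map M.PiG.subtype ⊔ M.baseSec j := by
  have hc : IsClosed ((((M.cuspGp j).map M.PiG.subtype ⊔ M.baseSec j : Subgroup M.P)) : Set M.P) := by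
    rw [← DvCusp_eq_sup_baseSec M hne hprime]; exact M.isClosed_DvCusp hne hprime j
  refine Subgroup.topologicalClosure_minimal _ ((Subgroup.zpowers_le).mpr ?_) hc
  exact Subgroup.mul_mem _ (Subgroup.mem_sup_left (M.inl_pow_mem_cuspGp_map j n))
    (Subgroup.mem_sup_right (Subgroup.pow_mem _ (M.baseGen_mem_baseSec j) i))

/-! ### The sections over the node at index `i` -/

/-- The generator `w^{-m} · t₀^i` of the node section of slope `m` (`w = ι(c₁c₂)`).
[cite: MochizukiAbsTopII2013, Prop 1.3 (x) p.12] -/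
def nodeGenIdx (m : ℕ) : M.P :=
  ((M.ι (SemidirectProduct.inl (c 1 * c 2 : PuncturedSurfaceGroup 0 4))) ^ m)⁻¹ *
    M.ι (SemidirectProduct.inr (Multiplicative.ofAdd (1 : ℤ))) ^ i

/-- **The node section of slope `m`**: `closure ⟨w^{-m} · t₀^i⟩ ⊆ I_e = Π_e · closure ⟨t₀^i⟩` — the graph of
`closure ⟨t₀^i⟩ → Π_e`, `t₀^i ↦ w^{-m}`; for `0 < m < i` it is the section of a log point over the node (`ξ ↦ m·σ`,
`η ↦ (i−m)·σ`). [cite: MochizukiAbsTopII2013, Prop 1.3 (x) p.12] -/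
def nodeSection (m : ℕ) : Subgroup M.P := (Subgroup.zpowers (M.nodeGenIdx i m)).topologicalClosure

/-- `w^{-m} t₀^i ∈ nodeSection i m`. [cite: MochizukiAbsTopII2013, Prop 1.3 (x) p.12] -/
theorem nodeGenIdx_mem (m : ℕ) : M.nodeGenIdx i m ∈ M.nodeSection i m :=
  Subgroup.le_topologicalClosure _ (Subgroup.mem_zpowers _)

/-- `nodeSection i m` is closed. [cite: MochizukiAbsTopII2013, Prop 1.3 (x) p.12] -/
theorem isClosed_nodeSection (m : ℕ) : IsClosed ((M.nodeSection i m : Subgroup M.P) : Set M.P) :=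
  Subgroup.isClosed_topologicalClosure _

/-- Slope `0` over the node is the inertia section `I_{v_A} = closure ⟨t₀^i⟩`. [cite: MochizukiAbsTopII2013, Prop 1.3 (x) p.12] -/
theorem nodeSection_zero : M.nodeSection i 0 = M.Tpow i := by
  rw [nodeSection, nodeGenIdx, pow_zero, inv_one, one_mul]; rfl

/-- Slope `i` over the node is the inertia section `I_{v_B} = closure ⟨u₀^i⟩` (`u₀^i = w^{-i} t₀^i`).
[cite: MochizukiAbsTopII2013, Prop 1.3 (x) p.12] -/
theorem nodeSection_self : M.nodeSection i i = M.Upow i := by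
  rw [nodeSection, nodeGenIdx, ← u0_pow_eq]; rfl

/-- `κG(c₁c₂)^{-m} ∈ Π_e`. [cite: MochizukiCombGC2007, Def 1.1(ii) p.7] -/
theorem κG_node_pow_inv_mem_nodeGp (m : ℕ) : (M.κG (c 1 * c 2) ^ m)⁻¹ ∈ M.nodeGp :=
  Subgroup.inv_mem _ (Subgroup.pow_mem _
    (Subgroup.le_topologicalClosure _ (Subgroup.mem_map_of_mem _ (Subgroup.mem_zpowers _))) m)

/-- **`nodeSection ∩ Π_𝔾 = 1`** (graph of `θ : closure ⟨t₀^i⟩ → Π_e`, `t₀^i ↦ w^{-m}`; `Π_e` commutes with `T`).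
[cite: MochizukiAbsTopII2013, Prop 1.3 (x) p.12] -/
theorem nodeSection_inf_PiG (hi : IsSigmaInteger Sigma i) (m : ℕ) : M.nodeSection i m ⊓ M.PiG = ⊥ := by
  have h := M.graphSection_inf_PiG (Subgroup.isClosed_topologicalClosure _) (M.isFreeProSigmaCyclic_Tpow i hi) rfl
    (M.t0_pow_mem_Tpow i) (M.Tpow_inf_PiG i) (Subgroup.isClosed_topologicalClosure _)
    (fun s hs x hx => M.W_commute_Tpow i x hx s hs) (M.κG_node_pow_inv_mem_nodeGp m)
  rw [InvMemClass.coe_inv, SubmonoidClass.coe_pow, coe_κG] at h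
  exact h

/-- **`nodeSection · Π_𝔾 = Π_I^{(i)}`**. [cite: MochizukiAbsTopII2013, Prop 1.3 (x) p.12] -/
theorem nodeSection_sup_PiG (m : ℕ) : M.nodeSection i m ⊔ M.PiG = M.PiIdx i :=
  M.graphSection_sup_PiG (Subgroup.isClosed_topologicalClosure _) rfl (M.t0_pow_mem_Tpow i)
    (M.PiG.inv_mem (M.w_pow_mem_PiG m))

/-- `nodeSection ⊆ Π_I^{(i)}`. [cite: MochizukiAbsTopII2013, Prop 1.3 (x) p.12] -/
theorem nodeSection_le_PiIdx (m : ℕ) : M.nodeSection i m ≤ M.PiIdx i := by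
  rw [← M.nodeSection_sup_PiG i m]; exact le_sup_left

/-- **`nodeSection ⊆ I_e = Π_e · closure ⟨t₀^i⟩`**. [cite: MochizukiAbsTopII2013, Prop 1.3 (x) p.12] -/
theorem nodeSection_le_W_sup_Tpow (m : ℕ) : M.nodeSection i m ≤ (M.nodeGp).map M.PiG.subtype ⊔ M.Tpow i :=
  Subgroup.topologicalClosure_minimal _ ((Subgroup.zpowers_le).mpr
    (Subgroup.mul_mem _ (Subgroup.mem_sup_left (Subgroup.inv_mem _ (Subgroup.pow_mem _ M.ι_node_mem_W m)))
      (Subgroup.mem_sup_right (M.t0_pow_mem_Tpow i)))) (M.coe_W_sup_Tpow i).2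

/-! ### The family of log points at node index `i` -/

/-- **Labels of the log points of the degenerating 4-pointed sphere with node index `i`** (with repetitions): a smooth
point of the component `v` (conjugator `δ ∈ P`), a log point over the cusp `c_j` of slope `n ≥ 1`, or — for `i ≥ 2` — a
log point over the NODE of slope `m`, `0 < m < i`. [cite: MochizukiAbsTopII2013, Prop 1.3 (x) p.12] -/
inductive LogPtIdx (M : Model Sigma) (i : ℕ) : Type
  /-- a smooth point of the irreducible component `v`, section `δ I_v δ⁻¹` -/
  | smooth (v : Fin 2) (δ : M.P)
  /-- a log point mapping to the cusp `c_j`, section `δ · closure ⟨ι(c_j)^n s_j^i⟩ · δ⁻¹`, `n ≥ 1` -/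
  | cusp (j : Fin 4) (n : ℕ) (hn : 0 < n) (δ : M.P)
  /-- a log point mapping to the node, section `δ · closure ⟨w^{-m} t₀^i⟩ · δ⁻¹`, `0 < m < i` -/
  | node (m : ℕ) (hm : 0 < m) (hmi : m < i) (δ : M.P)

section
variable (hne : Sigma.Nonempty) (hprime : ∀ p ∈ Sigma, p.Prime) (hi : IsSigmaInteger Sigma i)

/-- **The log points of the index-`i` two-vertex nodal model** as labelled sections (`DPSCIndexData.LogPointData`):
smooth points of `v` ↦ (`δ I_v δ⁻¹`, smooth `v`); over the cusp `c_j` ↦ (`δ·closure ⟨ι(c_j)^n s_j^i⟩·δ⁻¹`, cusp `c_j`);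
over the node ↦ (`δ·closure ⟨w^{-m} t₀^i⟩·δ⁻¹`, node), `0 < m < i`.  The statement of record `Prop_1_3_x''` is evaluated
on this family in `TwoTripodNodalIndexProp13x.lean`. [cite: MochizukiAbsTopII2013, Prop 1.3 (x) p.12] -/
def logPointsIdx : M.LogPtIdx i → (M.dpscIdx hne hprime i hi).LogPointData
  | LogPtIdx.smooth v δ =>
    { image := MulAut.conj δ • M.vertSecIdx i v
      image_le := M.conj_smul_le_PiIdx i (by rw [← M.vertSecIdx_sup_PiG i v]; exact le_sup_left) δ
      isClosed_image := M.isClosed_conj_smul (M.isClosed_vertSecIdx i v) δ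
      image_inf := by rw [dpscIdx_PiG]; exact M.conj_smul_inf_PiG_eq_bot (M.vertSecIdx_inf_PiG i hne hprime v) δ
      image_sup := by rw [dpscIdx_PiG]; exact M.conj_smul_sup_PiG_eq_PiIdx i (M.vertSecIdx_sup_PiG i v) δ
      kind := DPSCIndexData.PointKind.smooth ⟨v⟩ }
  | LogPtIdx.cusp j n _ δ =>
    { image := MulAut.conj δ • M.cuspSectionIdx i j n
      image_le := M.conj_smul_le_PiIdx i (M.cuspSectionIdx_le_PiIdx i j n) δ
      isClosed_image := M.isClosed_conj_smul (M.isClosed_cuspSectionIdx i j n) δ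
      image_inf := by rw [dpscIdx_PiG]; exact M.conj_smul_inf_PiG_eq_bot (M.cuspSectionIdx_inf_PiG i hne hprime hi j n) δ
      image_sup := by rw [dpscIdx_PiG]; exact M.conj_smul_sup_PiG_eq_PiIdx i (M.cuspSectionIdx_sup_PiG i j n) δ
      kind := DPSCIndexData.PointKind.cusp ⟨j⟩ }
  | LogPtIdx.node m _ _ δ =>
    { image := MulAut.conj δ • M.nodeSection i m
      image_le := M.conj_smul_le_PiIdx i (M.nodeSection_le_PiIdx i m) δ
      isClosed_image := M.isClosed_conj_smul (M.isClosed_nodeSection i m) δ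
      image_inf := by rw [dpscIdx_PiG]; exact M.conj_smul_inf_PiG_eq_bot (M.nodeSection_inf_PiG i hi m) δ
      image_sup := by rw [dpscIdx_PiG]; exact M.conj_smul_sup_PiG_eq_PiIdx i (M.nodeSection_sup_PiG i m) δ
      kind := DPSCIndexData.PointKind.node ⟨()⟩ }

/-- The smooth member `(v, δ)` has section `δ I_v δ⁻¹`. [cite: MochizukiAbsTopII2013, Prop 1.3 (x) p.12] -/
theorem logPointsIdx_smooth_image (v : Fin 2) (δ : M.P) :
    (M.logPointsIdx i hne hprime hi (LogPtIdx.smooth v δ)).image = MulAut.conj δ • M.vertSecIdx i v := rfl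

/-- The smooth member `(v, δ)` is labelled "smooth point of `v`". [cite: MochizukiAbsTopII2013, Prop 1.3 (x) p.12] -/
theorem logPointsIdx_smooth_kind (v : Fin 2) (δ : M.P) :
    (M.logPointsIdx i hne hprime hi (LogPtIdx.smooth v δ)).kind = DPSCIndexData.PointKind.smooth ⟨v⟩ := rfl

/-- The cusp member `(j, n, δ)` has section `δ · cuspSectionIdx · δ⁻¹`. [cite: MochizukiAbsTopII2013, Prop 1.3 (x) p.12] -/
theorem logPointsIdx_cusp_image (j : Fin 4) (n : ℕ) (hn : 0 < n) (δ : M.P) :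
    (M.logPointsIdx i hne hprime hi (LogPtIdx.cusp j n hn δ)).image = MulAut.conj δ • M.cuspSectionIdx i j n := rfl

/-- The cusp member `(j, n, δ)` is labelled "the cusp `c_j`". [cite: MochizukiAbsTopII2013, Prop 1.3 (x) p.12] -/
theorem logPointsIdx_cusp_kind (j : Fin 4) (n : ℕ) (hn : 0 < n) (δ : M.P) :
    (M.logPointsIdx i hne hprime hi (LogPtIdx.cusp j n hn δ)).kind = DPSCIndexData.PointKind.cusp ⟨j⟩ := rfl

/-- The node member `(m, δ)` has section `δ · nodeSection · δ⁻¹`. [cite: MochizukiAbsTopII2013, Prop 1.3 (x) p.12] -/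
theorem logPointsIdx_node_image (m : ℕ) (hm : 0 < m) (hmi : m < i) (δ : M.P) :
    (M.logPointsIdx i hne hprime hi (LogPtIdx.node m hm hmi δ)).image = MulAut.conj δ • M.nodeSection i m := rfl

/-- The node member `(m, δ)` is labelled "the node". [cite: MochizukiAbsTopII2013, Prop 1.3 (x) p.12] -/
theorem logPointsIdx_node_kind (m : ℕ) (hm : 0 < m) (hmi : m < i) (δ : M.P) :
    (M.logPointsIdx i hne hprime hi (LogPtIdx.node m hm hmi δ)).kind = DPSCIndexData.PointKind.node ⟨()⟩ := rfl

end

end Literature.AnabelianGeometry.AbsoluteAnabelian.AbsTopII.TwoTripodNodal.Model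

end
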